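import Summits.ResolutionOfSingularities.ResolutionOfSingularities.Theorems.EquisingularLiftEquisingularLiftNatSpecialFibreMaxPoints
import Summits.ResolutionOfSingularities.ResolutionOfSingularities.Theorems.EquisingularLiftEquisingularLiftProjectiveAmbientFibre
import Summits.ResolutionOfSingularities.ResolutionOfSingularities.Theorems.EquisingularLiftEquisingularLiftProjectiveAmbientSmoothProper
import Summits.ResolutionOfSingularities.ResolutionOfSingularities.Theorems.EquisingularLiftEquisingularLiftHorizResolutionBase
import Summits.ResolutionOfSingularities.ResolutionOfSingularities.Theorems.EquisingularLiftEquisingularLiftCentreBlowupSpecialFibreIntegral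
import HarnessLib

/-!
# [OURS · L1 W4.5(b) · EL♮] FIRST TOUCH with IRREDUCIBLE special fibres — towards the HORIZONTALITY of the touching
# centre in the necessity half `EquisingularLiftNat ⇒ ULT` (crux `EquisingularLiftNat` = stmt-ResolutionOfSingularities-20038)

HONEST FRAMING. OURS (cell res-hironaka, crux chain w45b, slot W4.5(b)); NOT a statement of any manuscript; AI-written,
weaker than expert review. Helper `--supports stmt-ResolutionOfSingularities-20038 --as helper`; sequel of
`…NatFirstTouch.lean` (p500156). Plan of record: L/w45b/CRUX-PLAN.md v3.0.1 §1.6 (ULT), L/w45b/EL-NATURAL/ULT-L0COMP-WORDS.md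
(§V «no vertical centres», §ULT).

WHY. The horizontality-free ULT is trivially true (STATUS res-L1-w45b-lead-1 2026-08-27T05:28Z): after zero steps the
VERTICAL centre `C₀ := V(closure {x})` (the curve itself, reduced) is regular whenever the curve is smooth, contains
`x`, lies over non-generic points and satisfies E1. What excludes vertical centres in the item is only its second
conclusion — the LAST special fibre is irreducible. This file transports that conclusion back to the touching step:

* TOOLKIT (companion file `…NatSpecialFibreMaxPoints.lean`): maximal points of the special fibre, persistence of
  reducibility and of «no maximal point in `closure Y'`» along a step, irreducible ⟺ one maximal point.
* `exists_touching_centre_irreducible_of_natChain` — FIRST TOUCH (general base `q : P → Spec O`, `P` Noetherian, `Y`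
  inside the special fibre and off its maximal points, LAST special fibre irreducible, LAST reduced strict transform
  regular): the touching stage `(X₀, σ₀, Y₀)`, centre `C₀ ∋ x₀ ↦ x` (regular, E1, non-generic) and a blow-up
  `τ₀ : X₁ → X₀` along `C₀` exist with BOTH special fibres `(σ₀ ≫ q)⁻¹{s₀}`, `(τ₀ ≫ σ₀ ≫ q)⁻¹{s₀}` IRREDUCIBLE.
* `exists_touching_centre_irreducible_of_equisingularLiftNat` — instantiated at the item (`H` a genuine
  hypersurface: some point of `ℙⁿ_k` is not in `range ι`).

WHAT IS NOT HERE («V», to follow): a regular centre with a VERTICAL component of codimension ≥ 2 makes the next special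
fibre reducible (exceptional divisor ⊇ a new maximal point; Krull's principal ideal theorem at the generic points of the
exceptional Cartier divisor). With it, the two irreducibility clauses give the topological horizontality
`x₀ ∈ closure (supp C₀ ∖ special fibre)` of the touching centre.

References: Görtz–Wedhorn I Prop. 13.91 (3) [GortzWedhorn2020]; Stacks 0052/004W (irreducible components, Noetherian
spaces), 01J3; tree: `Split.existsUnique_preimage`, `StrataSplit.stub_reducedStalkOverIso`, `IsBlowup.isProper`
(BlowupsProperProofs), `StrataSplit.isIntegral_specialFibre_projectiveSpace`, `StrataSplit.isIrreducible_preimage_closedPoint`,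
`StrataSplit.ProjectiveAmbientFibre.isPullback_projMap`, `stub_projectiveAmbientSmoothProper`.
-/

set_option linter.dupNamespace false -- mandated namespace `Summit.<Summit>.<Problem>` of this single-conjunct summit
set_option linter.overlappingInstances false -- item signatures carry `[IsDomain O] [IsDiscreteValuationRing O]`

open CategoryTheory AlgebraicGeometry TopologicalSpace Topology
open Literature.AlgebraicGeometry.Resolution
open AlgebraicGeometry.Scheme.IdealSheafData
open Summit.ResolutionOfSingularities.ResolutionOfSingularities.Theses.EquisingularLift.Split
open Summit.ResolutionOfSingularities.ResolutionOfSingularities.Cruxes.EquisingularLift.StrataSplit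

namespace Summit.ResolutionOfSingularities.ResolutionOfSingularities.Cruxes.EquisingularLiftNat.Sections
/-! ## FIRST TOUCH with irreducible special fibres (general base) -/

/-- **FIRST TOUCH, with the special fibres of the touching step IRREDUCIBLE (general base).** As
`exists_touching_centre_of_natChain`, for a Noetherian base scheme `P` (locally Noetherian and quasi-compact), `Y` inside
the special fibre and containing no point maximal for specialisation in the special fibre (e.g. `Y ≠` the irreducible
special fibre), and a chain whose LAST special fibre is irreducible (the item's second conclusion): then the touching stage
`(X₀, σ₀, Y₀)` and the blow-up `τ₀ : X₁ → X₀` along the touching centre `C₀` can be taken with BOTH special fibres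
`(σ₀ ≫ q)⁻¹{s₀}` and `(τ₀ ≫ σ₀ ≫ q)⁻¹{s₀}` irreducible — reducibility of the special fibre, once created, persists to
the end of the chain (`exists_two_maxPt_preimage_of_step`, `maxPt_not_mem_strictTransform_of_step`), where it is excluded.
This is the kernel form of «no vertical touching»: a centre with a vertical component of codimension ≥ 2 makes the next
special fibre reducible (not proved here). [folklore; GW I Prop. 13.91 (3)] -/
theorem exists_touching_centre_irreducible_of_natChain {O : Type} [CommRing O] [IsLocalRing O]
    {P : AlgebraicGeometry.Scheme.{0}} [AlgebraicGeometry.IsLocallyNoetherian P] [CompactSpace P]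
    (q : P ⟶ AlgebraicGeometry.Spec (.of O)) (Y : Set P) {P' : AlgebraicGeometry.Scheme.{0}} (σ : P' ⟶ P) (S' : Set P')
    (hch : (∀ Q : (∀ X' : AlgebraicGeometry.Scheme.{0}, (X' ⟶ P) → Set X' → Prop), Q P (CategoryTheory.CategoryStruct.id _) Y → (∀ (X' X'' : AlgebraicGeometry.Scheme.{0}) (σ' : X' ⟶ P) (Y' : Set X') (C : X'.IdealSheafData) (τ : X'' ⟶ X'), Q X' σ' Y' → Literature.AlgebraicGeometry.Resolution.IsBlowup τ C → Literature.AlgebraicGeometry.Resolution.Scheme.IsRegular C.subscheme → σ' '' (C.support : Set X') ⊆ {x | ¬ IsGenericPoint x Y} → (C.support : Set X') ∩ (CategoryTheory.CategoryStruct.comp σ' q) ⁻¹' {IsLocalRing.closedPoint O} ⊆ Y' → Q X'' (CategoryTheory.CategoryStruct.comp τ σ') (closure (τ ⁻¹' (Y' \ (C.support : Set X'))))) → Q P' σ S'))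
    (hirr : IsIrreducible ((CategoryTheory.CategoryStruct.comp σ q) ⁻¹' {IsLocalRing.closedPoint O}))
    (hreg : Literature.AlgebraicGeometry.Resolution.Scheme.IsRegular (AlgebraicGeometry.Scheme.IdealSheafData.vanishingIdeal (⟨closure S', isClosed_closure⟩ : TopologicalSpace.Closeds P')).subscheme)
    (hYF : Y ⊆ q ⁻¹' {IsLocalRing.closedPoint O})
    (hNM : ∀ w : P, (w ∈ q ⁻¹' {IsLocalRing.closedPoint O} ∧ ∀ y ∈ q ⁻¹' {IsLocalRing.closedPoint O}, y ⤳ w → y = w) →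
      w ∉ closure Y)
    {x : P} (hxY : x ∈ Y) (hx : (∃ w : ↥(AlgebraicGeometry.Scheme.IdealSheafData.vanishingIdeal (⟨closure Y, isClosed_closure⟩ : TopologicalSpace.Closeds P)).subscheme, (AlgebraicGeometry.Scheme.IdealSheafData.vanishingIdeal (⟨closure Y, isClosed_closure⟩ : TopologicalSpace.Closeds P)).subschemeι w = x ∧ ¬ IsRegularLocalRing ((AlgebraicGeometry.Scheme.IdealSheafData.vanishingIdeal (⟨closure Y, isClosed_closure⟩ : TopologicalSpace.Closeds P)).subscheme.presheaf.stalk w))) :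
    ∃ (X₀ : AlgebraicGeometry.Scheme.{0}) (σ₀ : X₀ ⟶ P) (Y₀ : Set X₀) (C₀ : X₀.IdealSheafData), (∀ Q : (∀ X' : AlgebraicGeometry.Scheme.{0}, (X' ⟶ P) → Set X' → Prop), Q P (CategoryTheory.CategoryStruct.id _) Y → (∀ (X' X'' : AlgebraicGeometry.Scheme.{0}) (σ' : X' ⟶ P) (Y' : Set X') (C : X'.IdealSheafData) (τ : X'' ⟶ X'), Q X' σ' Y' → Literature.AlgebraicGeometry.Resolution.IsBlowup τ C → Literature.AlgebraicGeometry.Resolution.Scheme.IsRegular C.subscheme → σ' '' (C.support : Set X') ⊆ {x | ¬ IsGenericPoint x Y} → (C.support : Set X') ∩ (CategoryTheory.CategoryStruct.comp σ' q) ⁻¹' {IsLocalRing.closedPoint O} ⊆ Y' → x ∉ σ' '' (C.support : Set X') → Q X'' (CategoryTheory.CategoryStruct.comp τ σ') (closure (τ ⁻¹' (Y' \ (C.support : Set X'))))) → Q X₀ σ₀ Y₀) ∧ Literature.AlgebraicGeometry.Resolution.Scheme.IsRegular C₀.subscheme ∧ (∃ x₀ : X₀, x₀ ∈ (C₀.support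 : Set X₀) ∧ σ₀ x₀ = x) ∧ σ₀ '' (C₀.support : Set X₀) ⊆ {x | ¬ IsGenericPoint x Y} ∧ (C₀.support : Set X₀) ∩ (CategoryTheory.CategoryStruct.comp σ₀ q) ⁻¹' {IsLocalRing.closedPoint O} ⊆ Y₀ ∧ IsIrreducible ((CategoryTheory.CategoryStruct.comp σ₀ q) ⁻¹' {IsLocalRing.closedPoint O}) ∧ ∃ (X₁ : AlgebraicGeometry.Scheme.{0}) (τ₀ : X₁ ⟶ X₀), Literature.AlgebraicGeometry.Resolution.IsBlowup τ₀ C₀ ∧ IsIrreducible ((CategoryTheory.CategoryStruct.comp (CategoryTheory.CategoryStruct.comp τ₀ σ₀) q) ⁻¹' {IsLocalRing.closedPoint O}) := by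
  -- local abbreviations
  let F : ∀ X' : Scheme.{0}, (X' ⟶ P) → Set X' := fun X' σ' =>
    (CategoryTheory.CategoryStruct.comp σ' q) ⁻¹' {IsLocalRing.closedPoint O}
  let MP : ∀ X' : Scheme.{0}, Set X' → X' → Prop := fun X' F w => w ∈ F ∧ ∀ y ∈ F, y ⤳ w → y = w
  let RED : ∀ X' : Scheme.{0}, (X' ⟶ P) → Prop := fun X' σ' =>
    ∃ w₁ w₂ : X', MP X' (F X' σ') w₁ ∧ MP X' (F X' σ') w₂ ∧ w₁ ≠ w₂
  let NM : ∀ X' : Scheme.{0}, (X' ⟶ P) → Set X' → Prop := fun X' σ' Y' =>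
    ∀ w : X', MP X' (F X' σ') w → w ∉ closure Y'
  let AV : ∀ X' : Scheme.{0}, (X' ⟶ P) → Set X' → Prop := fun X₀ σ₀ Y₀ =>
    (∀ Q : (∀ X' : AlgebraicGeometry.Scheme.{0}, (X' ⟶ P) → Set X' → Prop), Q P (CategoryTheory.CategoryStruct.id _) Y → (∀ (X' X'' : AlgebraicGeometry.Scheme.{0}) (σ' : X' ⟶ P) (Y' : Set X') (C : X'.IdealSheafData) (τ : X'' ⟶ X'), Q X' σ' Y' → Literature.AlgebraicGeometry.Resolution.IsBlowup τ C → Literature.AlgebraicGeometry.Resolution.Scheme.IsRegular C.subscheme → σ' '' (C.support : Set X') ⊆ {x | ¬ IsGenericPoint x Y} → (C.support : Set X') ∩ (CategoryTheory.CategoryStruct.comp σ' q) ⁻¹' {IsLocalRing.closedPoint O} ⊆ Y' → x ∉ σ' '' (C.support : Set X') → Q X'' (CategoryTheory.CategoryStruct.comp τ σ') (closure (τ ⁻¹' (Y' \ (C.support : Set X'))))) → Q X₀ σ₀ Y₀)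
  let NR : ∀ X' : Scheme.{0}, (X' ⟶ P) → Set X' → Prop := fun X' σ' Y' =>
    ∃ x' : X', x' ∈ Y' ∧ σ' x' = x ∧ (∃ w : ↥(AlgebraicGeometry.Scheme.IdealSheafData.vanishingIdeal (⟨closure Y', isClosed_closure⟩ : TopologicalSpace.Closeds X')).subscheme, (AlgebraicGeometry.Scheme.IdealSheafData.vanishingIdeal (⟨closure Y', isClosed_closure⟩ : TopologicalSpace.Closeds X')).subschemeι w = x' ∧ ¬ IsRegularLocalRing ((AlgebraicGeometry.Scheme.IdealSheafData.vanishingIdeal (⟨closure Y', isClosed_closure⟩ : TopologicalSpace.Closeds X')).subscheme.presheaf.stalk w))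
  have hFcl : ∀ (X' : Scheme.{0}) (σ' : X' ⟶ P), IsClosed (F X' σ') := fun X' σ' =>
    (IsLocalRing.isClosed_singleton_closedPoint O).preimage (CategoryTheory.CategoryStruct.comp σ' q).base.hom.continuous
  have hFstep : ∀ (X' X'' : Scheme.{0}) (σ' : X' ⟶ P) (τ : X'' ⟶ X'),
      F X'' (CategoryTheory.CategoryStruct.comp τ σ') = τ ⁻¹' F X' σ' := by
    intro X' X'' σ' τ
    ext v
    simp only [F, Set.mem_preimage, Scheme.Hom.comp_apply]
  -- run the E1-closure
  have key := hch (fun X' σ' Y' => (IsLocallyNoetherian X' ∧ CompactSpace X') ∧ Y' ⊆ F X' σ' ∧ NM X' σ' Y' ∧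
      ((∃ (X₀ : AlgebraicGeometry.Scheme.{0}) (σ₀ : X₀ ⟶ P) (Y₀ : Set X₀) (C₀ : X₀.IdealSheafData), (∀ Q : (∀ X' : AlgebraicGeometry.Scheme.{0}, (X' ⟶ P) → Set X' → Prop), Q P (CategoryTheory.CategoryStruct.id _) Y → (∀ (X' X'' : AlgebraicGeometry.Scheme.{0}) (σ' : X' ⟶ P) (Y' : Set X') (C : X'.IdealSheafData) (τ : X'' ⟶ X'), Q X' σ' Y' → Literature.AlgebraicGeometry.Resolution.IsBlowup τ C → Literature.AlgebraicGeometry.Resolution.Scheme.IsRegular C.subscheme → σ' '' (C.support : Set X') ⊆ {x | ¬ IsGenericPoint x Y} → (C.support : Set X') ∩ (CategoryTheory.CategoryStruct.comp σ' q) ⁻¹' {IsLocalRing.closedPoint O} ⊆ Y' → x ∉ σ' '' (C.support : Set X') → Q X'' (CategoryTheory.CategoryStruct.comp τ σ') (closure (τ ⁻¹' (Y' \ (C.support : Set X'))))) → Q X₀ σ₀ Y₀) ∧ Literature.AlgebraicGeometry.Resolution.Scheme.IsRegular C₀.subscheme ∧ (∃ x₀ : X₀, x₀ ∈ (C₀.support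 : Set X₀) ∧ σ₀ x₀ = x) ∧ σ₀ '' (C₀.support : Set X₀) ⊆ {x | ¬ IsGenericPoint x Y} ∧ (C₀.support : Set X₀) ∩ (CategoryTheory.CategoryStruct.comp σ₀ q) ⁻¹' {IsLocalRing.closedPoint O} ⊆ Y₀ ∧ IsIrreducible ((CategoryTheory.CategoryStruct.comp σ₀ q) ⁻¹' {IsLocalRing.closedPoint O}) ∧ ∃ (X₁ : AlgebraicGeometry.Scheme.{0}) (τ₀ : X₁ ⟶ X₀), Literature.AlgebraicGeometry.Resolution.IsBlowup τ₀ C₀ ∧ IsIrreducible ((CategoryTheory.CategoryStruct.comp (CategoryTheory.CategoryStruct.comp τ₀ σ₀) q) ⁻¹' {IsLocalRing.closedPoint O})) ∨ RED X' σ' ∨ (AV X' σ' Y' ∧ NR X' σ' Y'))) ?_ ?_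
  · obtain ⟨-, -, -, hG | hred | ⟨-, x', -, -, w, -, hw⟩⟩ := key
    · exact hG
    · obtain ⟨w₁, w₂, hw₁, hw₂, hne⟩ := hred
      exact absurd (maxPt_unique_of_isIrreducible hirr (hFcl P' σ) hw₁ hw₂) hne
    · exact absurd (hreg w) hw
  · -- base
    refine ⟨⟨inferInstance, inferInstance⟩, ?_, ?_, Or.inr (Or.inr ⟨fun Q h0 _ => h0, x, hxY, by simp, hx⟩)⟩
    · simpa [F] using hYF
    · simpa [NM, MP, F] using hNM
  · intro X' X'' σ' Y' C τ hQ hbl hC hgen hE1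
    obtain ⟨⟨hN', hc'⟩, hSF, hnm, hQ⟩ := hQ
    haveI := hN'
    haveI := hc'
    haveI : IsProper τ := hbl.isProper
    haveI : IsLocallyNoetherian X'' := LocallyOfFiniteType.isLocallyNoetherian τ
    haveI : CompactSpace X'' := QuasiCompact.compactSpace_of_compactSpace τ
    haveI : AlgebraicGeometry.IsNoetherian X'' := AlgebraicGeometry.IsNoetherian.mk
    -- the next special fibre is the preimage of this one
    have hF'' : F X'' (CategoryTheory.CategoryStruct.comp τ σ') = τ ⁻¹' F X' σ' := hFstep X' X'' σ' τ
    -- maximal points of the special fibre are off the centre (E1 + no maximal point in `closure Y'`)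
    have hNMC : ∀ w, MP X' (F X' σ') w → w ∉ (C.support : Set X') := fun w hw hwC =>
      hnm w hw (subset_closure (hE1 ⟨hwC, hw.1⟩))
    have hSF'' : closure (τ ⁻¹' (Y' \ (C.support : Set X'))) ⊆ F X'' (CategoryTheory.CategoryStruct.comp τ σ') := by
      rw [hF'']
      exact closure_minimal (fun v ⟨hv, _⟩ => hSF hv) ((hFcl X' σ').preimage τ.base.hom.continuous)
    have hnm'' : NM X'' (CategoryTheory.CategoryStruct.comp τ σ') (closure (τ ⁻¹' (Y' \ (C.support : Set X')))) := by
      intro w hw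
      rw [hF''] at hw
      exact maxPt_not_mem_strictTransform_of_step τ C hbl (F X' σ') (hFcl X' σ') Y' hSF hnm w hw
    have hredstep : RED X' σ' → RED X'' (CategoryTheory.CategoryStruct.comp τ σ') := by
      intro hred
      obtain ⟨v₁, v₂, hv₁, hv₂, hne⟩ := exists_two_maxPt_preimage_of_step τ C hbl (F X' σ') hNMC hred
      refine ⟨v₁, v₂, ?_, ?_, hne⟩
      · rw [hF'']; exact hv₁
      · rw [hF'']; exact hv₂
    refine ⟨⟨inferInstance, inferInstance⟩, hSF'', hnm'', ?_⟩
    rcases hQ with hG | hred | ⟨hav, x', hx'Y, hx'x, w, hw, hwreg⟩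
    · exact Or.inl hG
    · exact Or.inr (Or.inl (hredstep hred))
    · by_cases hxc : x ∈ σ' '' (C.support : Set X')
      · -- FIRST TOUCH at this step; either some special fibre is reducible (and stays so) or both are irreducible
        by_cases hred : RED X' σ' ∨ RED X'' (CategoryTheory.CategoryStruct.comp τ σ')
        · rcases hred with h | h
          · exact Or.inr (Or.inl (hredstep h))
          · exact Or.inr (Or.inl h)
        · push Not at hred
          obtain ⟨hred', hred''⟩ := hred
          have huniq' : ∀ w₁ w₂, MP X' (F X' σ') w₁ → MP X' (F X' σ') w₂ → w₁ = w₂ := by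
            intro w₁ w₂ h₁ h₂; by_contra hne; exact hred' ⟨w₁, w₂, h₁, h₂, hne⟩
          have huniq'' : ∀ w₁ w₂, MP X'' (F X'' (CategoryTheory.CategoryStruct.comp τ σ')) w₁ →
              MP X'' (F X'' (CategoryTheory.CategoryStruct.comp τ σ')) w₂ → w₁ = w₂ := by
            intro w₁ w₂ h₁ h₂; by_contra hne; exact hred'' ⟨w₁, w₂, h₁, h₂, hne⟩
          have hirr' : IsIrreducible (F X' σ') :=
            isIrreducible_of_maxPt_unique (hFcl X' σ') ⟨x', hSF hx'Y⟩ huniq'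
          -- a point of the next special fibre: the lift of a maximal point of this one
          obtain ⟨m, hm, -⟩ := exists_maxPt_specializes (hFcl X' σ') (hSF hx'Y)
          obtain ⟨m'', hm'', -, -⟩ := exists_maxPt_preimage_of_step τ C hbl (F X' σ') hm (hNMC m hm)
          have hirr'' : IsIrreducible (F X'' (CategoryTheory.CategoryStruct.comp τ σ')) :=
            isIrreducible_of_maxPt_unique (hFcl X'' _) ⟨m'', by rw [hF'']; show τ m'' ∈ F X' σ'; rw [hm'']; exact hm.1⟩
              huniq''
          obtain ⟨x₀, hx₀, hx₀x⟩ := hxc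
          exact Or.inl ⟨X', σ', Y', C, hav, hC, ⟨x₀, hx₀, hx₀x⟩, hgen, hE1, hirr', X'', τ, hbl, hirr''⟩
      · -- the centre misses `x`
        refine Or.inr (Or.inr ⟨fun Q h0 hs => hs X' X'' σ' Y' C τ (hav Q h0 hs) hbl hC hgen hE1 hxc, ?_⟩)
        have hx'C : x' ∉ (C.support : Set X') := fun h => hxc ⟨x', h, hx'x⟩
        obtain ⟨x'', hx'', hmem, z, hz, hzreg⟩ := nonregular_point_persists τ C hbl Y' hx'Y hx'C w hw hwreg
        refine ⟨x'', hmem, ?_, z, hz, hzreg⟩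
        rw [Scheme.Hom.comp_apply, hx'', hx'x]


/-! ## FIRST TOUCH with irreducible special fibres, for the item `EquisingularLiftNat` -/


/-- **FIRST TOUCH for EL♮, with the special fibres of the touching step IRREDUCIBLE.** If `EquisingularLiftNat p` holds
then, for the `O, π` it provides and every `φ, Y` as in the item — provided `H` is a genuine hypersurface (`ι` not onto
`ℙⁿ_k`) — every point `x ∈ Y` at which `V(closure Y)` is not regular is touched after an `x`-avoiding E1-chain by a regular
centre `C₀` (E1, non-generic) at a stage `X₀` whose special fibre is IRREDUCIBLE, by a blow-up `τ₀ : X₁ → X₀` along `C₀`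
whose special fibre is IRREDUCIBLE too. (The vertical witness «`C₀` := the curve `closure {x}` itself», which satisfies
the horizontality-free conclusion trivially, is thereby excluded as soon as «vertical centre ⇒ reducible special fibre»
is available.) [OURS · L1 W4.5b] [folklore] -/
theorem exists_touching_centre_irreducible_of_equisingularLiftNat {p : ℕ}
    (h : Summit.ResolutionOfSingularities.ResolutionOfSingularities.Theorems.EquisingularLiftNat p) :
    p.Prime → ∀ (k : Type) [Field k] [CharP k p] [IsAlgClosed k] (n : ℕ) (H : AlgebraicGeometry.Scheme.{0}) (ι : H ⟶ (Literature.AlgebraicGeometry.Motives.projectiveSpace n k).left), AlgebraicGeometry.IsClosedImmersion ι → AlgebraicGeometry.IsIntegral H → (∀ y : (Literature.AlgebraicGeometry.Motives.projectiveSpace n k).left, ∃ U : (Literature.AlgebraicGeometry.Motives.projectiveSpace n k).left.affineOpens, y ∈ (U : (Literature.AlgebraicGeometry.Motives.projectiveSpace n k).left.Opens) ∧ (ι.ker.ideal U).IsPrincipal) → (∃ z : (Literature.AlgebraicGeometry.Motives.projectiveSpace n k).left, z ∉ Set.range ι) → ∃ (O : Type) (_ : CommRing O) (_ : IsDomain O)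 (_ : IsDiscreteValuationRing O) (_ : CharZero O) (π : O →+* k), Function.Surjective π ∧ (letI := MvPolynomial.gradedAlgebra (σ := Fin (n + 1)) (R := O); letI := MvPolynomial.gradedAlgebra (σ := Fin (n + 1)) (R := k); ∀ (φ : MvPolynomial.homogeneousSubmodule (Fin (n + 1)) O →+*ᵍ MvPolynomial.homogeneousSubmodule (Fin (n + 1)) k) (hφ' : HomogeneousIdeal.irrelevant (MvPolynomial.homogeneousSubmodule (Fin (n + 1)) k) ≤ (HomogeneousIdeal.irrelevant (MvPolynomial.homogeneousSubmodule (Fin (n + 1)) O)).map φ), (∀ s, φ s = MvPolynomial.map π s) → ∀ Y : Set (AlgebraicGeometry.Proj (MvPolynomial.homogeneousSubmodule (Fin (n + 1)) O)), Y = Set.range (CategoryTheory.CategoryStruct.comp ι (AlgebraicGeometry.Proj.map φ hφ') : H ⟶ (AlgebraicGeometry.Proj (MvPolynomial.homogeneousSubmodule (Fin (n + 1)) O))) → ∀ x : (AlgebraicGeometry.Proj (MvPolynomial.homogeneousSubmodule (Fin (n + 1)) O)), x ∈ Y → (∃ w : ↥(AlgebraicGeometry.Scheme.IdealSheafData.vanishingIdeal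 (⟨closure Y, isClosed_closure⟩ : TopologicalSpace.Closeds (AlgebraicGeometry.Proj (MvPolynomial.homogeneousSubmodule (Fin (n + 1)) O)))).subscheme, (AlgebraicGeometry.Scheme.IdealSheafData.vanishingIdeal (⟨closure Y, isClosed_closure⟩ : TopologicalSpace.Closeds (AlgebraicGeometry.Proj (MvPolynomial.homogeneousSubmodule (Fin (n + 1)) O)))).subschemeι w = x ∧ ¬ IsRegularLocalRing ((AlgebraicGeometry.Scheme.IdealSheafData.vanishingIdeal (⟨closure Y, isClosed_closure⟩ : TopologicalSpace.Closeds (AlgebraicGeometry.Proj (MvPolynomial.homogeneousSubmodule (Fin (n + 1)) O)))).subscheme.presheaf.stalk w)) → ∃ (X₀ : AlgebraicGeometry.Scheme.{0}) (σ₀ : X₀ ⟶ (AlgebraicGeometry.Proj (MvPolynomial.homogeneousSubmodule (Fin (n + 1)) O))) (Y₀ : Set X₀) (C₀ : X₀.IdealSheafData), (∀ Q : (∀ X' : AlgebraicGeometry.Scheme.{0}, (X' ⟶ (AlgebraicGeometry.Proj (MvPolynomial.homogeneousSubmodule (Fin (n + 1)) O))) → Set X' → Prop), Q (AlgebraicGeometry.Proj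 (MvPolynomial.homogeneousSubmodule (Fin (n + 1)) O)) (CategoryTheory.CategoryStruct.id _) Y → (∀ (X' X'' : AlgebraicGeometry.Scheme.{0}) (σ' : X' ⟶ (AlgebraicGeometry.Proj (MvPolynomial.homogeneousSubmodule (Fin (n + 1)) O))) (Y' : Set X') (C : X'.IdealSheafData) (τ : X'' ⟶ X'), Q X' σ' Y' → Literature.AlgebraicGeometry.Resolution.IsBlowup τ C → Literature.AlgebraicGeometry.Resolution.Scheme.IsRegular C.subscheme → σ' '' (C.support : Set X') ⊆ {x | ¬ IsGenericPoint x Y} → (C.support : Set X') ∩ (CategoryTheory.CategoryStruct.comp σ' (CategoryTheory.CategoryStruct.comp (AlgebraicGeometry.Proj.toSpecZero (MvPolynomial.homogeneousSubmodule (Fin (n + 1)) O)) (AlgebraicGeometry.Spec.map (CommRingCat.ofHom (algebraMap O (MvPolynomial.homogeneousSubmodule (Fin (n + 1)) O 0)))))) ⁻¹' {IsLocalRing.closedPoint O} ⊆ Y' → x ∉ σ' '' (C.support : Set X') → Q X'' (CategoryTheory.CategoryStruct.comp τ σ') (closure (τ ⁻¹' (Y' \ (C.support : Set X'))))) → Q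 X₀ σ₀ Y₀) ∧ Literature.AlgebraicGeometry.Resolution.Scheme.IsRegular C₀.subscheme ∧ (∃ x₀ : X₀, x₀ ∈ (C₀.support : Set X₀) ∧ σ₀ x₀ = x) ∧ σ₀ '' (C₀.support : Set X₀) ⊆ {x | ¬ IsGenericPoint x Y} ∧ (C₀.support : Set X₀) ∩ (CategoryTheory.CategoryStruct.comp σ₀ (CategoryTheory.CategoryStruct.comp (AlgebraicGeometry.Proj.toSpecZero (MvPolynomial.homogeneousSubmodule (Fin (n + 1)) O)) (AlgebraicGeometry.Spec.map (CommRingCat.ofHom (algebraMap O (MvPolynomial.homogeneousSubmodule (Fin (n + 1)) O 0)))))) ⁻¹' {IsLocalRing.closedPoint O} ⊆ Y₀ ∧ IsIrreducible ((CategoryTheory.CategoryStruct.comp σ₀ (CategoryTheory.CategoryStruct.comp (AlgebraicGeometry.Proj.toSpecZero (MvPolynomial.homogeneousSubmodule (Fin (n + 1)) O)) (AlgebraicGeometry.Spec.map (CommRingCat.ofHom (algebraMap O (MvPolynomial.homogeneousSubmodule (Fin (n + 1)) O 0)))))) ⁻¹' {IsLocalRing.closedPoint O}) ∧ ∃ (X₁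 : AlgebraicGeometry.Scheme.{0}) (τ₀ : X₁ ⟶ X₀), Literature.AlgebraicGeometry.Resolution.IsBlowup τ₀ C₀ ∧ IsIrreducible ((CategoryTheory.CategoryStruct.comp (CategoryTheory.CategoryStruct.comp τ₀ σ₀) (CategoryTheory.CategoryStruct.comp (AlgebraicGeometry.Proj.toSpecZero (MvPolynomial.homogeneousSubmodule (Fin (n + 1)) O)) (AlgebraicGeometry.Spec.map (CommRingCat.ofHom (algebraMap O (MvPolynomial.homogeneousSubmodule (Fin (n + 1)) O 0)))))) ⁻¹' {IsLocalRing.closedPoint O})) := by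
  intro hp k _ _ _ n H ι hι hH hloc hH'
  obtain ⟨O, i1, i2, i3, i4, π, hπ, h'⟩ := h hp k n H ι hι hH hloc
  refine ⟨O, i1, i2, i3, i4, π, hπ, ?_⟩
  letI := MvPolynomial.gradedAlgebra (σ := Fin (n + 1)) (R := O)
  letI := MvPolynomial.gradedAlgebra (σ := Fin (n + 1)) (R := k)
  intro φ hφ' hφ Y hY x hxY hx
  obtain ⟨P', σ, S', hchain, hirr, hreg⟩ := h' φ hφ' hφ Y hY
  -- the base `q : ℙⁿ_O → Spec O` is proper, so `ℙⁿ_O` is a Noetherian scheme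
  set q : Proj (MvPolynomial.homogeneousSubmodule (Fin (n + 1)) O) ⟶ Spec (.of O) :=
    Proj.toSpecZero (MvPolynomial.homogeneousSubmodule (Fin (n + 1)) O) ≫
      Spec.map (CommRingCat.ofHom (algebraMap O (MvPolynomial.homogeneousSubmodule (Fin (n + 1)) O 0))) with hq
  obtain ⟨-, hprop⟩ := stub_projectiveAmbientSmoothProper O n
  haveI : IsProper q := hprop
  haveI : IsNoetherianRing (CommRingCat.of O) := inferInstanceAs (IsNoetherianRing O)
  haveI : IsLocallyNoetherian (Proj (MvPolynomial.homogeneousSubmodule (Fin (n + 1)) O)) :=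
    LocallyOfFiniteType.isLocallyNoetherian q
  haveI : CompactSpace ↥(Proj (MvPolynomial.homogeneousSubmodule (Fin (n + 1)) O)) :=
    QuasiCompact.compactSpace_of_compactSpace q
  -- `Y` lies in the special fibre (as in the instantiation file)
  set g : Proj (MvPolynomial.homogeneousSubmodule (Fin (n + 1)) k) ⟶
      Proj (MvPolynomial.homogeneousSubmodule (Fin (n + 1)) O) := Proj.map φ hφ' with hg
  have hP := ProjectiveAmbientFibre.isPullback_projMap π φ hφ hπ hφ'
  have hpt : ∀ z : Spec (.of k), Spec.map (CommRingCat.ofHom π) z = IsLocalRing.closedPoint O := by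
    intro z
    rw [Spec.map_apply]
    apply PrimeSpectrum.ext
    rw [PrimeSpectrum.comap_asIdeal, CommRingCat.hom_ofHom, Ideal.eq_bot_of_prime z.asIdeal, ← RingHom.ker_eq_comap_bot]
    exact IsLocalRing.eq_maximalIdeal (RingHom.ker_isMaximal_of_surjective π hπ)
  have hgq : ∀ z, q (g z) = IsLocalRing.closedPoint O := fun z ↦
    (Scheme.Hom.comp_apply g q z).symm.trans
      ((congrArg (fun h : Proj (MvPolynomial.homogeneousSubmodule (Fin (n + 1)) k) ⟶ Spec (.of O) ↦ h z) hP.w).trans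
        ((Scheme.Hom.comp_apply _ _ z).trans (hpt _)))
  have hYF : Y ⊆ q ⁻¹' {IsLocalRing.closedPoint O} := by
    rw [hY]
    rintro _ ⟨a, rfl⟩
    show q ((ι ≫ g) a) = IsLocalRing.closedPoint O
    rw [Scheme.Hom.comp_apply]
    exact hgq (ι a)
  -- `Y` contains no maximal point of the (irreducible) special fibre: that point is generic, and `Y ≠` the fibre
  have hirrP : IsIrreducible (q ⁻¹' {IsLocalRing.closedPoint O}) := by
    haveI := isIntegral_specialFibre_projectiveSpace O n
    exact isIrreducible_preimage_closedPoint O _ q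
  have hNM : ∀ w, (w ∈ q ⁻¹' {IsLocalRing.closedPoint O} ∧
      ∀ y ∈ q ⁻¹' {IsLocalRing.closedPoint O}, y ⤳ w → y = w) → w ∉ closure Y := by
    intro w hw hwY
    obtain ⟨ζ, hζ⟩ := QuasiSober.sober hirrP
      ((IsLocalRing.isClosed_singleton_closedPoint O).preimage q.base.hom.continuous)
    have hζw : ζ = w := hw.2 ζ hζ.mem (hζ.specializes hw.1)
    -- `closure Y = Y` is closed and contains the generic point, hence the whole special fibre
    haveI : IsClosedImmersion (Spec.map (CommRingCat.ofHom π)) := IsClosedImmersion.spec_of_surjective _ hπ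
    haveI : IsClosedImmersion g := MorphismProperty.IsStableUnderBaseChange.of_isPullback hP.flip inferInstance
    let ι' : H ⟶ Proj (MvPolynomial.homogeneousSubmodule (Fin (n + 1)) k) := ι
    haveI : IsClosedImmersion ι' := hι
    have hYcl : IsClosed Y := by rw [hY]; exact (ι' ≫ g).isClosedEmbedding.isClosed_range
    rw [hYcl.closure_eq] at hwY
    have hFY : q ⁻¹' {IsLocalRing.closedPoint O} ⊆ Y := by
      rw [← hζ.def, hζw]
      exact closure_minimal (Set.singleton_subset_iff.mpr hwY) hYcl
    -- but `g z ∈` the special fibre for the missing point `z ∉ range ι`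
    obtain ⟨z, hz⟩ := hH'
    have hgz : g z ∈ Y := hFY (hgq z)
    rw [hY] at hgz
    obtain ⟨a, ha⟩ := hgz
    rw [Scheme.Hom.comp_apply] at ha
    exact hz ⟨a, g.isClosedEmbedding.injective ha⟩
  exact exists_touching_centre_irreducible_of_natChain q Y σ S' hchain hirr hreg hYF hNM hxY hx


end Summit.ResolutionOfSingularities.ResolutionOfSingularities.Cruxes.EquisingularLiftNat.Sections
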